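import Literature.AlgebraicGeometry.Resolution.NodalDeformation
import Literature.AlgebraicGeometry.Resolution.AlterationsNodalFibre
import Literature.AlgebraicGeometry.Resolution.MvPowerSeriesNested
import HarnessLib

/-!
# De Jong's alteration theorem: 2.23 (split case) for the curve of Situation 4.23 — PROVED

Topic: `Literature/AlgebraicGeometry/Resolution`. De Jong 1996, 2.23: "If `f` is a split
semi-stable curve … The complete local ring of `X` at `x` is `B ≅ A⟦u, v⟧/(uv - h)` for some
`h ∈ A` [`A = 𝒪̂_{S,s}`]", and the first sentences of 3.3: "Let `A → A' → B` be as in 2.23, and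
choose an isomorphism `B ≅ A'⟦u, v⟧/(Q - h)`, with `h ∈ A'` (2.23). … Note that the elements
`t₁, …, t_r` form [part of] a regular system of parameters of `𝒪_{S,s}`, hence also of `A`".
For the curve `f : X → Y` of a pair in Situation 4.23 (`DeJong1996.SemiStablePair f g D τ`) over
an algebraically closed field `k`, at a CLOSED point `x` at which the fibre `X_{f x}` is
singular, this file PROVES:

* `DeJong1996.SemiStablePair.exists_ringEquiv_nodeDeformationRing` — **2.23, split case**: there
  are `h ∈ 𝔪_Â`, `Â = 𝒪̂_{Y,f x}`, and an isomorphism `Â⟦u, v⟧/(uv - h) ≅ 𝒪̂_{X,x}`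
  (`DeJong1996.NodeDeformationRing`, `AlterationsNodeLocalStructure.lean`) over the completed
  stalk map `𝒪̂_{Y,f x} → 𝒪̂_{X,x}` (`DeJong1996.completedStalkMap`). This is Liu 2002,
  Lemma 10.3.20 (`NodalDeformation.exists_ringEquiv_cpl`) fed with the three local inputs of
  `AlterationsNodalFibre.lean` (flatness of `𝒪_{Y,f x} → 𝒪_{X,x}`, equality of the residue
  fields at closed points, and the formal node `(𝒪_{X,x}/𝔪_{f x})^ ≅ k⟦u, v⟧/(uv)` from 2.21).
  It is the `h ∈ A` half of the named fact `DeJong1996NodeLocalStructure` (ibid.), which adds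
  3.3's `h = ε t₁^{n₁} ⋯ t_r^{n_r}`.
* `DeJong1996.SemiStablePair.exists_ringEquiv_nodalSeries` — the same in the coordinates of
  3.3/4.25: for generators `z₁, …, z_m` of `𝔪_{Y,f x}`, `m = dim 𝒪_{Y,f x}` (a regular system of
  parameters of the regular local ring `𝒪_{Y,f x}`; e.g. one adapted to `D`), there are a power
  series `h(t) ∈ k⟦t₁, …, t_m⟧` without constant term and an isomorphism
  `𝒪̂_{X,x} ≅ k⟦u, v, t₁, …, t_m⟧/(uv - h(t))` sending (the image of) `zᵢ` to `tᵢ` — by Cohen's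
  structure theorem in the sharp form `𝒪̂_{Y,f x} ≅ k⟦t⟧`, `zᵢ ↦ tᵢ`
  (`exists_ringEquiv_adicCompletion_stalk_mvPowerSeries`, `AlterationsFormalCoordinates.lean`)
  and `Â⟦u, v⟧ ≅ k⟦u, v, t⟧` (`MvPowerSeriesNested.nestedEquiv`). This is the shape of
  `DeJong1996SemiStableNodalPresentation` (`AlterationsCodimThreeNodalFormParts.lean`, whose
  model is `DeJong1996.NodalPowRing k m nn = k⟦u, v, t⟧/(uv - ∏ tᵢ^{nnᵢ})`) before 3.3 makes
  `h(t)` a monomial.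

## Sources

* A. J. de Jong, *Smoothness, semi-stability and alterations*, Publ. Math. IHÉS 83 (1996), 2.23
  (pp. 61–62), 3.3 (p. 63), 4.24 (p. 75).
* Q. Liu, *Algebraic Geometry and Arithmetic Curves* (2002), Lemma 10.3.20, Cor. 10.3.22.
-/

noncomputable section

open CategoryTheory CategoryTheory.Limits AlgebraicGeometry TopologicalSpace IsLocalRing

namespace Literature.AlgebraicGeometry.Resolution

universe u

namespace DeJong1996.SemiStablePair

variable {k : Type u} [Field k] {X Y : Scheme.{u}} {f : X ⟶ Y} {g : Y ⟶ Spec (.of k)}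
  {D : Set Y} {n : ℕ} {τ : Fin n → (Y ⟶ X)}

/-- **de Jong 1996, 2.23 (split case), for the curve of a pair in Situation 4.23 — PROVED.**
At a closed point `x` of `X` at which the fibre `X_{f x}` is singular there are a non-unit `h` of
`Â = 𝒪̂_{Y,f x}` (i.e. `h ∈ 𝔪_Â`) and an isomorphism `Â⟦u, v⟧/(uv - h) ≅ 𝒪̂_{X,x}` over the completed stalk map
`Â → 𝒪̂_{X,x}` ("The complete local ring of `X` at `x` is `B ≅ A⟦u, v⟧/(uv - h)` for some
`h ∈ A`"; Liu 2002, Lemma 10.3.20 with the inputs of `AlterationsNodalFibre.lean`).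
[cite: DeJong1996, 2.23, pp. 61–62] -/
theorem exists_ringEquiv_nodeDeformationRing [IsAlgClosed k] (hS : SemiStablePair f g D τ)
    {x : X} (hx : IsClosed ({x} : Set X))
    (hsing : ¬ IsRegularLocalRing ((f.fiber (f x)).presheaf.stalk (f.asFiber x))) :
    ∃ (h : AdicCompletion (maximalIdeal (Y.presheaf.stalk (f x))) (Y.presheaf.stalk (f x)))
      (e : DeJong1996.NodeDeformationRing _ h ≃+*
        AdicCompletion (maximalIdeal (X.presheaf.stalk x)) (X.presheaf.stalk x)),
      ¬ IsUnit h ∧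
      ∀ a, e (Ideal.Quotient.mk _ (MvPowerSeries.C a)) = DeJong1996.completedStalkMap f x a := by
  haveI := hS.isNoetherian_base
  haveI := hS.isIntegral
  haveI : IsNoetherian X := isNoetherian_of_isProjectiveOver _ hS.isProjectiveOver
  obtain ⟨efib⟩ := hS.nonempty_ringEquiv_fibreCompletion hx hsing
  obtain ⟨h, e, hh, hC⟩ := NodalDeformation.exists_ringEquiv_cpl (f.stalkMap x).hom
    (hS.residue_comp_stalkMap_surjective hx) (hS.stalkMap_flat x) efib
  exact ⟨h, e, (mem_maximalIdeal h).mp hh, hC⟩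

/-- The image of a non-unit under a ring isomorphism onto `k⟦t⟧` has no constant term.
[folklore] -/
theorem constantCoeff_eq_zero_of_not_isUnit {R : Type u} [CommRing R]
    {m : ℕ} (e : R ≃+* MvPowerSeries (Fin m) k) {a : R} (ha : ¬ IsUnit a) :
    MvPowerSeries.constantCoeff (e a) = 0 := by
  by_contra h0
  exact ha (by simpa using (MvPowerSeries.isUnit_iff_constantCoeff.mpr (Ne.isUnit h0)).map e.symm)

/-- **de Jong 1996, 2.23 (split case) in the coordinates of 3.3 — PROVED.** At a closed point `x`
of `X` at which the fibre `X_{f x}` is singular, for generators `z₁, …, z_m` of `𝔪_{Y,f x}`,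
`m = dim 𝒪_{Y,f x}`, there are `h(t) ∈ k⟦t₁, …, t_m⟧` without constant term and an isomorphism
`𝒪̂_{X,x} ≅ k⟦u, v, t₁, …, t_m⟧/(uv - h(t))` (`u = X (inl 0)`, `v = X (inl 1)`, `tᵢ = X (inr i)`,
`h(t)` embedded by `MvPowerSeriesNested.inrHom`) sending the image of `zᵢ` to `tᵢ` ("choose an
isomorphism `B ≅ A⟦u, v⟧/(uv - h)`, with `h ∈ A` … `t₁, …, t_r` form [part of] a regular system
of parameters of `𝒪_{S,s}`, hence also of `A`", with Cohen's `A = 𝒪̂_{Y,f x} ≅ k⟦t⟧`).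
[cite: DeJong1996, 2.23 and 3.3, pp. 61–63] -/
theorem exists_ringEquiv_nodalSeries [IsAlgClosed k] (hS : SemiStablePair f g D τ) {x : X}
    (hx : IsClosed ({x} : Set X))
    (hsing : ¬ IsRegularLocalRing ((f.fiber (f x)).presheaf.stalk (f.asFiber x))) {m : ℕ}
    (z : Fin m → Y.presheaf.stalk (f x))
    (hz : Ideal.span (Set.range z) = maximalIdeal (Y.presheaf.stalk (f x)))
    (hm : ringKrullDim (Y.presheaf.stalk (f x)) = m) :
    ∃ (h : MvPowerSeries (Fin m) k)
      (e : AdicCompletion (maximalIdeal (X.presheaf.stalk x)) (X.presheaf.stalk x) ≃+*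
        (MvPowerSeries (Fin 2 ⊕ Fin m) k ⧸ Ideal.span
          {(MvPowerSeries.X (Sum.inl 0) * MvPowerSeries.X (Sum.inl 1) -
            MvPowerSeriesNested.inrHom (Fin 2) (Fin m) k h : MvPowerSeries (Fin 2 ⊕ Fin m) k)})),
      MvPowerSeries.constantCoeff h = 0 ∧
      ∀ i, e (algebraMap _ _ ((f.stalkMap x).hom (z i))) =
        Ideal.Quotient.mk _ (MvPowerSeries.X (Sum.inr i)) := by
  have hy := hS.isClosed_image hx
  haveI : IsProper g :=
    Literature.AlgebraicGeometry.Motives.IsProjectiveOver.isProper (X := Over.mk g)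
      hS.isProjectiveOver_base
  haveI : IsRegularLocalRing (Y.presheaf.stalk (f x)) := hS.isRegular_base (f x)
  -- 2.23
  obtain ⟨h₀, e₀, hh₀, hC⟩ := hS.exists_ringEquiv_nodeDeformationRing hx hsing
  -- Cohen coordinates on the base: `Â ≅ k⟦t⟧`, `zᵢ ↦ tᵢ`
  obtain ⟨eA, heA⟩ := exists_ringEquiv_adicCompletion_stalk_mvPowerSeries g hy z hz hm
  let hser : MvPowerSeries (Fin m) k := eA h₀
  -- `Â⟦u, v⟧ ≅ k⟦u, v, t⟧`
  let E : MvPowerSeries (Fin 2)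
      (AdicCompletion (maximalIdeal (Y.presheaf.stalk (f x))) (Y.presheaf.stalk (f x))) ≃+*
      MvPowerSeries (Fin 2 ⊕ Fin m) k :=
    (MvPowerSeries.mapRingEquiv eA).trans (MvPowerSeriesNested.nestedEquiv (Fin 2) (Fin m) k).symm
  have hEX : ∀ j : Fin 2, E (MvPowerSeries.X j) = MvPowerSeries.X (Sum.inl j) := fun j => by
    change (MvPowerSeriesNested.nestedEquiv (Fin 2) (Fin m) k).symm
      (MvPowerSeries.mapRingEquiv eA (MvPowerSeries.X j)) = _
    rw [MvPowerSeries.mapRingEquiv_X, RingEquiv.symm_apply_eq, MvPowerSeriesNested.nestedEquiv_X_inl]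
  have hEC : ∀ a, E (MvPowerSeries.C a) = MvPowerSeriesNested.inrHom (Fin 2) (Fin m) k (eA a) :=
    fun a => by
      change (MvPowerSeriesNested.nestedEquiv (Fin 2) (Fin m) k).symm
        (MvPowerSeries.map (σ := Fin 2) eA.toRingHom (MvPowerSeries.C a)) = _
      rw [MvPowerSeries.map_C]
      rfl
  have hErel : E (DeJong1996.nodeDeformationRelation _ h₀) =
      MvPowerSeries.X (Sum.inl 0) * MvPowerSeries.X (Sum.inl 1) -
        MvPowerSeriesNested.inrHom (Fin 2) (Fin m) k hser := by
    rw [DeJong1996.nodeDeformationRelation, map_sub, map_mul, hEX, hEX, hEC]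
  -- the isomorphism
  let e₁ : DeJong1996.NodeDeformationRing _ h₀ ≃+*
      (MvPowerSeries (Fin 2 ⊕ Fin m) k ⧸ Ideal.span
        {(MvPowerSeries.X (Sum.inl 0) * MvPowerSeries.X (Sum.inl 1) -
          MvPowerSeriesNested.inrHom (Fin 2) (Fin m) k hser : MvPowerSeries (Fin 2 ⊕ Fin m) k)}) :=
    Ideal.quotientEquiv _ _ E (by rw [Ideal.map_span, Set.image_singleton, RingEquiv.coe_toRingHom, hErel])
  refine ⟨hser, e₀.symm.trans e₁, constantCoeff_eq_zero_of_not_isUnit eA hh₀, fun i => ?_⟩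
  -- `zᵢ ↦ tᵢ`
  have h1 : algebraMap _ (AdicCompletion (maximalIdeal (X.presheaf.stalk x)) (X.presheaf.stalk x))
      ((f.stalkMap x).hom (z i)) =
        e₀ (Ideal.Quotient.mk _ (MvPowerSeries.C (algebraMap _
          (AdicCompletion (maximalIdeal (Y.presheaf.stalk (f x))) (Y.presheaf.stalk (f x))) (z i)))) := by
    rw [hC, AdicCompletion.algebraMap_apply, Algebra.algebraMap_self_apply,
      AdicCompletion.algebraMap_apply, Algebra.algebraMap_self_apply, DeJong1996.completedStalkMap_of]
  rw [RingEquiv.trans_apply, h1, RingEquiv.symm_apply_apply]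
  change Ideal.quotientEquiv _ _ E _ (Ideal.Quotient.mk _ (MvPowerSeries.C (algebraMap _
    (AdicCompletion (maximalIdeal (Y.presheaf.stalk (f x))) (Y.presheaf.stalk (f x))) (z i)))) = _
  rw [Ideal.quotientEquiv_mk, hEC, heA, MvPowerSeriesNested.inrHom_X]

end DeJong1996.SemiStablePair

end Literature.AlgebraicGeometry.Resolution

end
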